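import Literature.MathematicalPhysics.KineticTheory.LangevinChainGibbs
import Summits.AtomisticToContinuum.FouriersLaw.Theses.OddSectorIrreversibility

/-!
# `OddDensityIsCorrector`, part 3a: bilinear integration by parts against `e^{-H/T}`

Helper file for support item `stmt-AtomisticToContinuum-9146`
(`OddSectorIrreversibility.OddDensityIsCorrector`).

Bilinear versions of the two integrations by parts of `LangevinChainGibbs.lean` (there with the
second factor `k = 1`), for an oscillator chain with `C¹` potentials and the Gibbs density
`ρ_T = e^{-H/T}`:

* `integral_liouville_mul_mul_gibbsDensity` — the Hamiltonian vector field is ANTISYMMETRIC in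
  `L²(e^{-H/T} dx)`: `∫ (p_i ∂_{q_i}F - ∂_{q_i}H ∂_{p_i}F) k ρ_T = ∫ F (-p_i ∂_{q_i}k + ∂_{q_i}H ∂_{p_i}k) ρ_T`
  (`F ∈ C¹_c`, `k ∈ C¹`);
* `integral_bath_mul_mul_gibbsDensity` — each Ornstein–Uhlenbeck bath term at the Gibbs temperature
  is SYMMETRIC: `∫ (T ∂²_{p_i}F - p_i ∂_{p_i}F) k ρ_T = ∫ F (T ∂²_{p_i}k - p_i ∂_{p_i}k) ρ_T`
  (`F ∈ C²_c`, `k ∈ C²`, `T ≠ 0`).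

Together they give `L† = ΘLΘ` for the equilibrium generator (next file). Nothing here closes an item.
-/

noncomputable section

open MeasureTheory Filter Topology Set Function
open scoped ContDiff
open Literature.MathematicalPhysics.KineticTheory.HeatConduction

namespace Summit.AtomisticToContinuum.FouriersLaw.Theorems.OddSectorIrreversibility

variable {N : ℕ}

section IBP

variable (P : OscillatorChain) (hU : ContDiff ℝ 1 P.U) (hV : ContDiff ℝ 1 P.V) (N : ℕ) (T : ℝ)
include hU hV

/-- **Liouville part, bilinear.** For `F ∈ C¹_c`, `k ∈ C¹`:
`∫ (p_i ∂_{q_i}F - ∂_{q_i}H ∂_{p_i}F) k e^{-H/T} = ∫ F (-p_i ∂_{q_i}k + ∂_{q_i}H ∂_{p_i}k) e^{-H/T}`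
(the Hamiltonian vector field is antisymmetric in `L²(e^{-H/T} dx)`: two integrations by parts,
the `e^{-H/T}`-derivative terms cancel). [cite: CuneoEckmannHairerReyBellet2018, §3.1] -/
theorem integral_liouville_mul_mul_gibbsDensity {F k : PhaseSpace N → ℝ} (hF : ContDiff ℝ 1 F)
    (hFc : HasCompactSupport F) (hk : ContDiff ℝ 1 k) (i : Fin N) :
    ∫ x, (x.2 i * partialQ i F x - partialQ i (P.hamiltonian N) x * partialP i F x) * k x *
        P.gibbsDensity N T x =
      ∫ x, F x * (-(x.2 i) * partialQ i k x + partialQ i (P.hamiltonian N) x * partialP i k x) *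
        P.gibbsDensity N T x := by
  have hH1 : ContDiff ℝ 1 (P.hamiltonian N) := P.contDiff_hamiltonian hU hV N
  have hHd : Differentiable ℝ (P.hamiltonian N) := hH1.differentiable one_ne_zero
  have hFd : Differentiable ℝ F := hF.differentiable one_ne_zero
  have hkd : Differentiable ℝ k := hk.differentiable one_ne_zero
  have hρc : Continuous (P.gibbsDensity N T) := P.continuous_gibbsDensity hU.continuous hV.continuous N T
  have hWc : Continuous (partialQ i (P.hamiltonian N)) := P.continuous_partialQ_hamiltonian hH1 i
  have hQc : Continuous (partialQ i F) := continuous_partialQ hF one_ne_zero i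
  have hPc : Continuous (partialP i F) := continuous_partialP hF one_ne_zero i
  have hQkc : Continuous (partialQ i k) := continuous_partialQ hk one_ne_zero i
  have hPkc : Continuous (partialP i k) := continuous_partialP hk one_ne_zero i
  have hpc : Continuous fun x : PhaseSpace N => x.2 i := (continuous_apply i).comp continuous_snd
  -- `∂_{q_i}` of `p_i k ρ` and `∂_{p_i}` of `∂_{q_i}H k ρ`
  have hline1 : ∀ x : PhaseSpace N, HasLineDerivAt ℝ (fun y : PhaseSpace N => y.2 i * k y * P.gibbsDensity N T y)
      (x.2 i * (partialQ i k x * P.gibbsDensity N T x +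
        k x * (-(partialQ i (P.hamiltonian N) x / T) * P.gibbsDensity N T x))) x
      ((Pi.single i 1, 0) : PhaseSpace N) := by
    intro x
    have hρ' := P.hasLineDerivAt_gibbsDensity (T := T) (P.hasLineDerivAt_hamiltonian_unitQ hHd x i)
    have hk' := hasLineDerivAt_partialQ hkd i x
    unfold HasLineDerivAt at hρ' hk' ⊢
    have hkρ := hk'.mul hρ'
    have := hkρ.const_mul (x.2 i)
    simp only [zero_smul, add_zero] at this
    refine this.congr_of_eventuallyEq (Eventually.of_forall fun t => ?_)
    simp only [add_smul_unitQ_snd, Pi.mul_apply]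
    ring
  have hline2 : ∀ x : PhaseSpace N, HasLineDerivAt ℝ
      (fun y : PhaseSpace N => partialQ i (P.hamiltonian N) y * k y * P.gibbsDensity N T y)
      (partialQ i (P.hamiltonian N) x * (partialP i k x * P.gibbsDensity N T x +
        k x * (-(x.2 i / T) * P.gibbsDensity N T x))) x ((0, Pi.single i 1) : PhaseSpace N) := by
    intro x
    have hρ' := P.hasLineDerivAt_gibbsDensity (T := T) (P.hasLineDerivAt_hamiltonian_unitP N x i)
    have hk' := hasLineDerivAt_partialP hkd i x
    unfold HasLineDerivAt at hρ' hk' ⊢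
    have hkρ := hk'.mul hρ'
    have := hkρ.const_mul (partialQ i (P.hamiltonian N) x)
    simp only [zero_smul, add_zero] at this
    refine this.congr_of_eventuallyEq (Eventually.of_forall fun t => ?_)
    simp only [P.partialQ_hamiltonian_add_smul_unitP, Pi.mul_apply]
    ring
  have e1 := integral_mul_eq_neg_of_hasLineDerivAt (v := ((Pi.single i 1, 0) : PhaseSpace N))
    (F := fun y : PhaseSpace N => y.2 i * k y * P.gibbsDensity N T y)
    (F' := fun x => x.2 i * (partialQ i k x * P.gibbsDensity N T x +
        k x * (-(partialQ i (P.hamiltonian N) x / T) * P.gibbsDensity N T x)))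
    (g := F) (g' := partialQ i F) (by fun_prop) (by fun_prop) hF.continuous hQc hFc
    (hasCompactSupport_partialQ hFd hFc i) hline1 (fun x => hasLineDerivAt_partialQ hFd i x)
  have e2 := integral_mul_eq_neg_of_hasLineDerivAt (v := ((0, Pi.single i 1) : PhaseSpace N))
    (F := fun y : PhaseSpace N => partialQ i (P.hamiltonian N) y * k y * P.gibbsDensity N T y)
    (F' := fun x => partialQ i (P.hamiltonian N) x * (partialP i k x * P.gibbsDensity N T x +
        k x * (-(x.2 i / T) * P.gibbsDensity N T x)))
    (g := F) (g' := partialP i F) (by fun_prop) (by fun_prop) hF.continuous hPc hFc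
    (hasCompactSupport_partialP hFd hFc i) hline2 (fun x => hasLineDerivAt_partialP hFd i x)
  -- assemble
  have iA : Integrable fun x => (x.2 i * k x * P.gibbsDensity N T x) * partialQ i F x :=
    (((hpc.mul hk.continuous).mul hρc).mul hQc).integrable_of_hasCompactSupport
      (hasCompactSupport_partialQ hFd hFc i).mul_left
  have iB : Integrable fun x => (partialQ i (P.hamiltonian N) x * k x * P.gibbsDensity N T x) * partialP i F x :=
    (((hWc.mul hk.continuous).mul hρc).mul hPc).integrable_of_hasCompactSupport
      (hasCompactSupport_partialP hFd hFc i).mul_left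
  have hsplit : (fun x => (x.2 i * partialQ i F x - partialQ i (P.hamiltonian N) x * partialP i F x) * k x *
      P.gibbsDensity N T x) = fun x => (x.2 i * k x * P.gibbsDensity N T x) * partialQ i F x -
        (partialQ i (P.hamiltonian N) x * k x * P.gibbsDensity N T x) * partialP i F x := by
    funext x; ring
  rw [hsplit, integral_sub iA iB, e1, e2]
  have iC : Integrable fun x => (x.2 i * (partialQ i k x * P.gibbsDensity N T x +
      k x * (-(partialQ i (P.hamiltonian N) x / T) * P.gibbsDensity N T x))) * F x :=
    ((hpc.mul ((hQkc.mul hρc).add (hk.continuous.mul ((hWc.div_const T).neg.mul hρc)))).mul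
      hF.continuous).integrable_of_hasCompactSupport hFc.mul_left
  have iD : Integrable fun x => (partialQ i (P.hamiltonian N) x * (partialP i k x * P.gibbsDensity N T x +
      k x * (-(x.2 i / T) * P.gibbsDensity N T x))) * F x :=
    ((hWc.mul ((hPkc.mul hρc).add (hk.continuous.mul ((hpc.div_const T).neg.mul hρc)))).mul
      hF.continuous).integrable_of_hasCompactSupport hFc.mul_left
  rw [neg_sub_neg, ← integral_sub iD iC]
  refine integral_congr_ae (Eventually.of_forall fun x => ?_)
  ring

/-- **Bath part, bilinear and symmetric.** For `F ∈ C²_c`, `k ∈ C²` and a bath at the Gibbs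
temperature `T` on momentum `p_i`:
`∫ (T ∂²_{p_i}F - p_i ∂_{p_i}F) k e^{-H/T} = -T ∫ ∂_{p_i}F ∂_{p_i}k e^{-H/T}
  = ∫ F (T ∂²_{p_i}k - p_i ∂_{p_i}k) e^{-H/T}` (the Ornstein–Uhlenbeck generator is symmetric in
`L²(e^{-H/T} dx)`). [cite: CuneoEckmannHairerReyBellet2018, §3.1] -/
theorem integral_bath_mul_mul_gibbsDensity (hT : T ≠ 0) {F k : PhaseSpace N → ℝ} (hF : ContDiff ℝ 2 F)
    (hFc : HasCompactSupport F) (hk : ContDiff ℝ 2 k) (i : Fin N) :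
    ∫ x, (T * partialP i (partialP i F) x - x.2 i * partialP i F x) * k x * P.gibbsDensity N T x =
      ∫ x, F x * (T * partialP i (partialP i k) x - x.2 i * partialP i k x) * P.gibbsDensity N T x := by
  have hFd : Differentiable ℝ F := hF.differentiable two_ne_zero
  have hkd : Differentiable ℝ k := hk.differentiable two_ne_zero
  have hF1 : ContDiff ℝ 1 (partialP i F) := contDiff_partialP hF (by norm_num) i
  have hk1 : ContDiff ℝ 1 (partialP i k) := contDiff_partialP hk (by norm_num) i
  have hF1d : Differentiable ℝ (partialP i F) := hF1.differentiable one_ne_zero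
  have hk1d : Differentiable ℝ (partialP i k) := hk1.differentiable one_ne_zero
  have hρc : Continuous (P.gibbsDensity N T) := P.continuous_gibbsDensity hU.continuous hV.continuous N T
  have hPc : Continuous (partialP i F) := hF1.continuous
  have hPPc : Continuous (partialP i (partialP i F)) := continuous_partialP hF1 one_ne_zero i
  have hPkc : Continuous (partialP i k) := hk1.continuous
  have hPPkc : Continuous (partialP i (partialP i k)) := continuous_partialP hk1 one_ne_zero i
  have hpc : Continuous fun x : PhaseSpace N => x.2 i := (continuous_apply i).comp continuous_snd
  have hPcs : HasCompactSupport (partialP i F) := hasCompactSupport_partialP hFd hFc i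
  have hPPcs : HasCompactSupport (partialP i (partialP i F)) := hasCompactSupport_partialP hF1d hPcs i
  -- left: `∫ T ∂²F (kρ) = -T ∫ ∂F ∂(kρ)`
  have hline1 : ∀ x : PhaseSpace N, HasLineDerivAt ℝ (fun y => k y * P.gibbsDensity N T y)
      (partialP i k x * P.gibbsDensity N T x + k x * (-(x.2 i / T) * P.gibbsDensity N T x)) x
      ((0, Pi.single i 1) : PhaseSpace N) := by
    intro x
    have hρ' := P.hasLineDerivAt_gibbsDensity (T := T) (P.hasLineDerivAt_hamiltonian_unitP N x i)
    have hk' := hasLineDerivAt_partialP hkd i x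
    unfold HasLineDerivAt at hρ' hk' ⊢
    have := hk'.mul hρ'
    simp only [zero_smul, add_zero] at this
    exact this
  have e1 := integral_mul_eq_neg_of_hasLineDerivAt (v := ((0, Pi.single i 1) : PhaseSpace N))
    (F := fun y => k y * P.gibbsDensity N T y)
    (F' := fun x => partialP i k x * P.gibbsDensity N T x + k x * (-(x.2 i / T) * P.gibbsDensity N T x))
    (g := partialP i F) (g' := partialP i (partialP i F)) (by fun_prop) (by fun_prop) hPc hPPc hPcs hPPcs
    hline1 (fun x => hasLineDerivAt_partialP hF1d i x)
  -- right: `∫ T ∂²k (Fρ) = -T ∫ ∂k ∂(Fρ)`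
  have hline2 : ∀ x : PhaseSpace N, HasLineDerivAt ℝ (fun y => F y * P.gibbsDensity N T y)
      (partialP i F x * P.gibbsDensity N T x + F x * (-(x.2 i / T) * P.gibbsDensity N T x)) x
      ((0, Pi.single i 1) : PhaseSpace N) := by
    intro x
    have hρ' := P.hasLineDerivAt_gibbsDensity (T := T) (P.hasLineDerivAt_hamiltonian_unitP N x i)
    have hF' := hasLineDerivAt_partialP hFd i x
    unfold HasLineDerivAt at hρ' hF' ⊢
    have := hF'.mul hρ'
    simp only [zero_smul, add_zero] at this
    exact this
  have e2 := integral_mul_eq_neg_of_hasLineDerivAt (v := ((0, Pi.single i 1) : PhaseSpace N))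
    (F := partialP i k) (F' := partialP i (partialP i k))
    (g := fun y => F y * P.gibbsDensity N T y)
    (g' := fun x => partialP i F x * P.gibbsDensity N T x + F x * (-(x.2 i / T) * P.gibbsDensity N T x))
    hPkc hPPkc (hF.continuous.mul hρc) (by fun_prop) (hFc.mul_right) ?_
    (fun x => hasLineDerivAt_partialP hk1d i x) hline2
  swap
  · exact (hPcs.mul_right (f' := P.gibbsDensity N T)).add (hFc.mul_right)
  -- both sides equal `-T ∫ ∂F ∂k ρ`
  have iL1 : Integrable fun x => T * partialP i (partialP i F) x * k x * P.gibbsDensity N T x :=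
    (((continuous_const.mul hPPc).mul hk.continuous).mul hρc).integrable_of_hasCompactSupport
      (hPPcs.mul_left.mul_right.mul_right)
  have iL2 : Integrable fun x => x.2 i * partialP i F x * k x * P.gibbsDensity N T x :=
    (((hpc.mul hPc).mul hk.continuous).mul hρc).integrable_of_hasCompactSupport
      (hPcs.mul_left.mul_right.mul_right)
  have iR1 : Integrable fun x => F x * (T * partialP i (partialP i k) x) * P.gibbsDensity N T x :=
    ((hF.continuous.mul (continuous_const.mul hPPkc)).mul hρc).integrable_of_hasCompactSupport
      (hFc.mul_right.mul_right)
  have iR2 : Integrable fun x => F x * (x.2 i * partialP i k x) * P.gibbsDensity N T x :=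
    ((hF.continuous.mul (hpc.mul hPkc)).mul hρc).integrable_of_hasCompactSupport
      (hFc.mul_right.mul_right)
  have hL : ∫ x, (T * partialP i (partialP i F) x - x.2 i * partialP i F x) * k x * P.gibbsDensity N T x =
      -T * ∫ x, partialP i F x * partialP i k x * P.gibbsDensity N T x := by
    have hsplit : (fun x => (T * partialP i (partialP i F) x - x.2 i * partialP i F x) * k x *
        P.gibbsDensity N T x) = fun x => T * partialP i (partialP i F) x * k x * P.gibbsDensity N T x -
          x.2 i * partialP i F x * k x * P.gibbsDensity N T x := by
      funext x; ring
    rw [hsplit, integral_sub iL1 iL2]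
    have h1 : ∫ x, T * partialP i (partialP i F) x * k x * P.gibbsDensity N T x =
        T * ∫ x, (k x * P.gibbsDensity N T x) * partialP i (partialP i F) x := by
      rw [← integral_const_mul]
      exact integral_congr_ae (Eventually.of_forall fun x => by ring)
    rw [h1, e1]
    have iX : Integrable fun x => partialP i F x * partialP i k x * P.gibbsDensity N T x :=
      ((hPc.mul hPkc).mul hρc).integrable_of_hasCompactSupport (hPcs.mul_right.mul_right)
    have h2 : ∫ x, (partialP i k x * P.gibbsDensity N T x + k x * (-(x.2 i / T) * P.gibbsDensity N T x)) *
        partialP i F x = (∫ x, partialP i F x * partialP i k x * P.gibbsDensity N T x) -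
          T⁻¹ * ∫ x, x.2 i * partialP i F x * k x * P.gibbsDensity N T x := by
      rw [← integral_const_mul, ← integral_sub iX (iL2.const_mul _)]
      exact integral_congr_ae (Eventually.of_forall fun x => by ring)
    rw [h2]
    field_simp
    ring
  have hR : ∫ x, F x * (T * partialP i (partialP i k) x - x.2 i * partialP i k x) * P.gibbsDensity N T x =
      -T * ∫ x, partialP i F x * partialP i k x * P.gibbsDensity N T x := by
    have hsplit : (fun x => F x * (T * partialP i (partialP i k) x - x.2 i * partialP i k x) *
        P.gibbsDensity N T x) = fun x => F x * (T * partialP i (partialP i k) x) * P.gibbsDensity N T x -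
          F x * (x.2 i * partialP i k x) * P.gibbsDensity N T x := by
      funext x; ring
    rw [hsplit, integral_sub iR1 iR2]
    have h1 : ∫ x, F x * (T * partialP i (partialP i k) x) * P.gibbsDensity N T x =
        T * ∫ x, partialP i (partialP i k) x * (F x * P.gibbsDensity N T x) := by
      rw [← integral_const_mul]
      exact integral_congr_ae (Eventually.of_forall fun x => by ring)
    have e2' : ∫ x, partialP i (partialP i k) x * (F x * P.gibbsDensity N T x) =
        -∫ x, partialP i k x * (partialP i F x * P.gibbsDensity N T x +
          F x * (-(x.2 i / T) * P.gibbsDensity N T x)) := by linarith [e2]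
    rw [h1, e2']
    have iX : Integrable fun x => partialP i F x * partialP i k x * P.gibbsDensity N T x :=
      ((hPc.mul hPkc).mul hρc).integrable_of_hasCompactSupport (hPcs.mul_right.mul_right)
    have h2 : ∫ x, partialP i k x * (partialP i F x * P.gibbsDensity N T x +
        F x * (-(x.2 i / T) * P.gibbsDensity N T x)) =
          (∫ x, partialP i F x * partialP i k x * P.gibbsDensity N T x) -
            T⁻¹ * ∫ x, F x * (x.2 i * partialP i k x) * P.gibbsDensity N T x := by
      rw [← integral_const_mul, ← integral_sub iX (iR2.const_mul _)]
      exact integral_congr_ae (Eventually.of_forall fun x => by ring)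
    rw [h2]
    field_simp
    ring
  rw [hL, hR]

end IBP

end Summit.AtomisticToContinuum.FouriersLaw.Theorems.OddSectorIrreversibility

end
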